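import Mathlib
import HarnessLib
import Summits.NavierStokesRegularity.NavierStokesRegularity.Theorems.PoloidalWindowDoorLrcModEntireTwistingTHJetTools

/-!
# Item `LrcModEntire` (stmt-NavierStokesRegularity-20428), skeleton twist_split v6 — T1 cell, step (I), JET stub: (S) STRUCTURE and (T) LEADING ORDER of the z-jets

Cell ns-regularity-ideate, seat ns-k2-port-2 g4 (free hand; `--supports stmt-NavierStokesRegularity-20428 --as helper`).  Sub-steps (S), (T) of `stub_flatPlane_badData`
(LEAD ns-poloidal-K2-p3 g13, `Cruxes/LrcModEntire/T1StepI.lean`, CELLS-TH-g13 §2ter), CLASS-FREE, for an ANALYTIC field `u : ℝ³ → ℝ³` (the slice `v(−1,·)`),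
the flat plane `P₀ = {x₂ = 0}` parametrised by a linear embedding `ι : ℝ² → ℝ³` (`(ι x)₀ = x₀`, `(ι x)₁ = x₁`, `(ι x)₂ = 0`), and the z-JETS given through
DEFINING HYPOTHESES (no new definitions):

  `B k x = Dᵏu₂(ι x)(e₂,…,e₂)`   (`k`-th `z`-derivative of `u₂` on the plane),   `A j x i = Dʲ⁺¹u_i(ι x)(e₂,…,e₂)`, `i = 0, 1`   (horizontal jets `a⁽ʲ⁾`).

* bookkeeping: `exists_planarEmbedding`, `embed_single`, `contDiff_jetB/A`, `fderiv_jetB/A_apply` (planar derivatives of the jets = jets of the spatial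
  derivatives — `…TwistingTHJetTools.fderiv_jet_apply`), `iteratedFDeriv_succ_const`, `iteratedDeriv_line_fderiv`;
* **(S)** `curl_jetA` — `ω₂ ≡ 0` ⇒ `∂₀A_j,₁ = ∂₁A_j,₀`;  `div_jetA` — `div u ≡ 0` ⇒ `∂₀A_j,₀ + ∂₁A_j,₁ = −B_{j+2}`;
* **(T)** `thLeading` — the bilinear (TH) identity on the planes `{x₂ = z}` (`∂₂u_b(x)·∂_c u₂(x') = ∂₂u_c(x')·∂_b u₂(x)`, `x₂ = x'₂`, `b, c ≠ 2`) at its lowest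
  non-trivial `z`-order `j₁ + k₀` (`A j ≡ 0` for `j < j₁`; `B 0 ≡ const`, `B k ≡ 0` for `1 ≤ k < k₀`):
  `A j₁ x i · ∂ₗ(B k₀)(x') = A j₁ x' l · ∂ᵢ(B k₀)(x)` — the hypothesis `hTH` of `…TwistingTHJetEndgame.badData_of_planarJets`.

WHAT THIS IS NOT: not a claim about Navier–Stokes regularity — generic jet calculus for the T1 cell (bears_on LADDER-NS N0, item 20428 / crux 19708; both OPEN).
-/

noncomputable section

-- the summit and its single sub-problem share the name (CONVENTIONS §1), as in every Theorems file
set_option linter.dupNamespace false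

namespace Summit.NavierStokesRegularity.NavierStokesRegularity.Theorems.PoloidalWindowDoorLrcModEntireTwistingTHJetStructure

open Set Function Filter Topology
open scoped Topology ContDiff
open Summit.NavierStokesRegularity.NavierStokesRegularity.Theorems.PoloidalWindowDoorLrcModEntireTwistingTHJetTools

/-! ### The planar embedding -/

/-- The embedding `ℝ² → ℝ³`, `x ↦ (x₀, x₁, 0)`, as a continuous linear map. -/
theorem exists_planarEmbedding :
    ∃ ι : EuclideanSpace ℝ (Fin 2) →L[ℝ] EuclideanSpace ℝ (Fin 3), (∀ x, ι x 0 = x 0) ∧ (∀ x, ι x 1 = x 1) ∧ ∀ x, ι x 2 = 0 := by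
  set ι : EuclideanSpace ℝ (Fin 2) →L[ℝ] EuclideanSpace ℝ (Fin 3) :=
    (EuclideanSpace.equiv (Fin 3) ℝ).symm.toContinuousLinearMap.comp
      (ContinuousLinearMap.pi fun i : Fin 3 =>
        if (i : ℕ) < 2 then EuclideanSpace.proj (𝕜 := ℝ) (⟨(i : ℕ) % 2, Nat.mod_lt _ two_pos⟩ : Fin 2) else 0) with hιdef
  refine ⟨ι, fun x => ?_, fun x => ?_, fun x => ?_⟩ <;> simp [hιdef]

section Jets

variable {u : EuclideanSpace ℝ (Fin 3) → EuclideanSpace ℝ (Fin 3)} {ι : EuclideanSpace ℝ (Fin 2) →L[ℝ] EuclideanSpace ℝ (Fin 3)}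
  {B : ℕ → EuclideanSpace ℝ (Fin 2) → ℝ} {A : ℕ → EuclideanSpace ℝ (Fin 2) → EuclideanSpace ℝ (Fin 2)}

/-- `ι` maps the planar basis to `e₀, e₁`. -/
theorem embed_single (hι0 : ∀ x, ι x 0 = x 0) (hι1 : ∀ x, ι x 1 = x 1) (hι2 : ∀ x, ι x 2 = 0) (l : Fin 2) :
    ι (EuclideanSpace.single l 1) = EuclideanSpace.single (Fin.castSucc l) 1 := by
  ext i
  fin_cases i <;> fin_cases l <;> simp [hι0, hι1, hι2]

/-- Height of the line point `ι x + z e₂`. -/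
theorem embed_line_apply_two (hι2 : ∀ x, ι x 2 = 0) (x : EuclideanSpace ℝ (Fin 2)) (z : ℝ) :
    (ι x + z • EuclideanSpace.single (2 : Fin 3) (1 : ℝ)) 2 = z := by
  simp [hι2]

/-- Coordinates of an analytic field are analytic. -/
theorem analyticOnNhd_coord (hu : AnalyticOnNhd ℝ u univ) (i : Fin 3) : AnalyticOnNhd ℝ (fun y => u y i) univ := fun y _ =>
  ((EuclideanSpace.proj (𝕜 := ℝ) i).analyticAt _).comp (hu y (mem_univ _))

/-- `Dᵐ⁺¹f(x)(e,…,e) = Dᵐ[∂ₑf](x)(e,…,e)` (`f` smooth). -/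
theorem iteratedFDeriv_succ_const {E F : Type*} [NormedAddCommGroup E] [NormedSpace ℝ E] [NormedAddCommGroup F] [NormedSpace ℝ F] {f : E → F}
    (hf : ContDiff ℝ ∞ f) (m : ℕ) (x e : E) :
    iteratedFDeriv ℝ (m + 1) f x (fun _ => e) = iteratedFDeriv ℝ m (fun y => fderiv ℝ f y e) x (fun _ => e) := by
  rw [iteratedFDeriv_succ_apply_right]
  have hD : ContDiff ℝ ∞ (fun y => fderiv ℝ f y) := hf.fderiv_right (m := ∞) (by norm_cast)
  have h := iteratedFDeriv_clm_apply hD (ContinuousLinearMap.apply ℝ F e) x (m := m) (by exact_mod_cast le_top) (fun _ => e)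
  simp only [ContinuousLinearMap.apply_apply] at h
  rw [h]
  rfl

/-- Line derivatives of a first derivative: `(d/dz)ᵐ [∂_w f](x + z e)|₀ = Dᵐ[∂_w f](x)(e,…,e)`. -/
theorem iteratedDeriv_line_fderiv {E F : Type*} [NormedAddCommGroup E] [NormedSpace ℝ E] [NormedAddCommGroup F] [NormedSpace ℝ F] {f : E → F}
    (hf : ContDiff ℝ ∞ f) (m : ℕ) (x e w : E) :
    iteratedDeriv m (fun z : ℝ => fderiv ℝ f (x + z • e) w) 0 = iteratedFDeriv ℝ m (fun y => fderiv ℝ f y w) x (fun _ => e) := by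
  have hD : ContDiff ℝ ∞ (fun y => fderiv ℝ f y w) := hf.fderiv_right (m := ∞) (by norm_cast) |>.clm_apply contDiff_const
  have h := iteratedDeriv_lineRestrict hD x e (m := m) (by exact_mod_cast le_top) 0
  simpa using h

/-! ### Smoothness and planar derivatives of the jets -/

/-- The jets `B k` are smooth. -/
theorem contDiff_jetB (hu : AnalyticOnNhd ℝ u univ)
    (hB : ∀ k x, B k x = iteratedFDeriv ℝ k (fun y => u y 2) (ι x) (fun _ => EuclideanSpace.single (2 : Fin 3) (1 : ℝ))) (k : ℕ) {N : WithTop ℕ∞} :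
    ContDiff ℝ N (B k) := by
  have hf : ContDiff ℝ ω (fun y => u y 2) := (analyticOnNhd_coord hu 2).contDiff
  have h1 : ContDiff ℝ ω (iteratedFDeriv ℝ k (fun y => u y 2)) := hf.iteratedFDeriv_right (m := ω) le_top
  have h2 : ContDiff ℝ ω (fun y => iteratedFDeriv ℝ k (fun y => u y 2) y (fun _ => EuclideanSpace.single (2 : Fin 3) (1 : ℝ))) :=
    (ContinuousMultilinearMap.apply ℝ (fun _ : Fin k => EuclideanSpace ℝ (Fin 3)) ℝ (fun _ => EuclideanSpace.single (2 : Fin 3) (1 : ℝ))).contDiff.comp h1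
  have e : B k = (fun y => iteratedFDeriv ℝ k (fun y => u y 2) y (fun _ => EuclideanSpace.single (2 : Fin 3) (1 : ℝ))) ∘ ι := by
    funext x; simp [hB]
  rw [e]
  exact (h2.of_le le_top).comp ι.contDiff

/-- The components of the jets `A j` are smooth. -/
theorem contDiff_jetA_coord (hu : AnalyticOnNhd ℝ u univ)
    (hA : ∀ j x (i : Fin 2), A j x i = iteratedFDeriv ℝ (j + 1) (fun y => u y (Fin.castSucc i)) (ι x) (fun _ => EuclideanSpace.single (2 : Fin 3) (1 : ℝ)))
    (j : ℕ) (i : Fin 2) {N : WithTop ℕ∞} : ContDiff ℝ N (fun x => A j x i) := by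
  have hf : ContDiff ℝ ω (fun y => u y (Fin.castSucc i)) := (analyticOnNhd_coord hu _).contDiff
  have h1 : ContDiff ℝ ω (iteratedFDeriv ℝ (j + 1) (fun y => u y (Fin.castSucc i))) := hf.iteratedFDeriv_right (m := ω) le_top
  have h2 : ContDiff ℝ ω (fun y => iteratedFDeriv ℝ (j + 1) (fun y => u y (Fin.castSucc i)) y (fun _ => EuclideanSpace.single (2 : Fin 3) (1 : ℝ))) :=
    (ContinuousMultilinearMap.apply ℝ (fun _ : Fin (j + 1) => EuclideanSpace ℝ (Fin 3)) ℝ (fun _ => EuclideanSpace.single (2 : Fin 3) (1 : ℝ))).contDiff.comp h1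
  have e : (fun x => A j x i) = (fun y => iteratedFDeriv ℝ (j + 1) (fun y => u y (Fin.castSucc i)) y (fun _ => EuclideanSpace.single (2 : Fin 3) (1 : ℝ))) ∘ ι := by
    funext x; simp [hA]
  rw [e]
  exact (h2.of_le le_top).comp ι.contDiff

/-- The jets `A j` are smooth. -/
theorem contDiff_jetA (hu : AnalyticOnNhd ℝ u univ)
    (hA : ∀ j x (i : Fin 2), A j x i = iteratedFDeriv ℝ (j + 1) (fun y => u y (Fin.castSucc i)) (ι x) (fun _ => EuclideanSpace.single (2 : Fin 3) (1 : ℝ)))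
    (j : ℕ) {N : WithTop ℕ∞} : ContDiff ℝ N (A j) :=
  contDiff_piLp' 2 fun i => contDiff_jetA_coord hu hA j i

/-- Planar derivative of a function of the form `x ↦ Dᵐf(ι x)(e₂,…,e₂)`, `f` analytic: `= Dᵐ[∂_{e_l} f](ι x)(e₂,…,e₂)`. -/
theorem fderiv_jet_comp_embed {f : EuclideanSpace ℝ (Fin 3) → ℝ} (hf : AnalyticOnNhd ℝ f univ)
    (hι0 : ∀ x, ι x 0 = x 0) (hι1 : ∀ x, ι x 1 = x 1) (hι2 : ∀ x, ι x 2 = 0) (m : ℕ) (x : EuclideanSpace ℝ (Fin 2)) (l : Fin 2) :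
    fderiv ℝ (fun x => iteratedFDeriv ℝ m f (ι x) (fun _ => EuclideanSpace.single (2 : Fin 3) (1 : ℝ))) x (EuclideanSpace.single l 1) =
      iteratedFDeriv ℝ m (fun y => fderiv ℝ f y (EuclideanSpace.single (Fin.castSucc l) 1)) (ι x)
        (fun _ => EuclideanSpace.single (2 : Fin 3) (1 : ℝ)) := by
  set G : EuclideanSpace ℝ (Fin 3) → ℝ := fun y => iteratedFDeriv ℝ m f y (fun _ => EuclideanSpace.single (2 : Fin 3) (1 : ℝ)) with hG
  have hGC : ContDiff ℝ ∞ G :=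
    (ContinuousMultilinearMap.apply ℝ (fun _ : Fin m => EuclideanSpace ℝ (Fin 3)) ℝ (fun _ => EuclideanSpace.single (2 : Fin 3) (1 : ℝ))).contDiff.comp
      (hf.contDiff.iteratedFDeriv_right (m := ∞) (by norm_cast))
  have hGd : DifferentiableAt ℝ G (ι x) := (hGC.differentiable (by simp)) _
  have hc : fderiv ℝ (fun x => G (ι x)) x = (fderiv ℝ G (ι x)).comp ι := (hGd.hasFDerivAt.comp x ι.hasFDerivAt).fderiv
  rw [show (fun x => iteratedFDeriv ℝ m f (ι x) fun _ => EuclideanSpace.single (2 : Fin 3) (1 : ℝ)) = fun x => G (ι x) from rfl, hc,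
    ContinuousLinearMap.comp_apply, embed_single hι0 hι1 hι2, hG, fderiv_jet_apply hf]

/-- **Planar derivatives of `B k`**: `∂ₗ(B k)(x) = Dᵏ[∂ₗu₂](ι x)(e₂,…,e₂)`. -/
theorem fderiv_jetB_apply (hu : AnalyticOnNhd ℝ u univ) (hι0 : ∀ x, ι x 0 = x 0) (hι1 : ∀ x, ι x 1 = x 1) (hι2 : ∀ x, ι x 2 = 0)
    (hB : ∀ k x, B k x = iteratedFDeriv ℝ k (fun y => u y 2) (ι x) (fun _ => EuclideanSpace.single (2 : Fin 3) (1 : ℝ))) (k : ℕ)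
    (x : EuclideanSpace ℝ (Fin 2)) (l : Fin 2) :
    fderiv ℝ (B k) x (EuclideanSpace.single l 1) =
      iteratedFDeriv ℝ k (fun y => fderiv ℝ (fun y => u y 2) y (EuclideanSpace.single (Fin.castSucc l) 1)) (ι x)
        (fun _ => EuclideanSpace.single (2 : Fin 3) (1 : ℝ)) := by
  have e : B k = fun x => iteratedFDeriv ℝ k (fun y => u y 2) (ι x) (fun _ => EuclideanSpace.single (2 : Fin 3) (1 : ℝ)) := by
    funext x; exact hB k x
  rw [e, fderiv_jet_comp_embed (analyticOnNhd_coord hu 2) hι0 hι1 hι2]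

/-- **Planar derivatives of the components of `A j`**: `∂ₗ(A j)ᵢ(x) = Dʲ⁺¹[∂ₗu_i](ι x)(e₂,…,e₂)`. -/
theorem fderiv_jetA_apply (hu : AnalyticOnNhd ℝ u univ) (hι0 : ∀ x, ι x 0 = x 0) (hι1 : ∀ x, ι x 1 = x 1) (hι2 : ∀ x, ι x 2 = 0)
    (hA : ∀ j x (i : Fin 2), A j x i = iteratedFDeriv ℝ (j + 1) (fun y => u y (Fin.castSucc i)) (ι x) (fun _ => EuclideanSpace.single (2 : Fin 3) (1 : ℝ)))
    (j : ℕ) (x : EuclideanSpace ℝ (Fin 2)) (l i : Fin 2) :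
    fderiv ℝ (A j) x (EuclideanSpace.single l 1) i =
      iteratedFDeriv ℝ (j + 1) (fun y => fderiv ℝ (fun y => u y (Fin.castSucc i)) y (EuclideanSpace.single (Fin.castSucc l) 1)) (ι x)
        (fun _ => EuclideanSpace.single (2 : Fin 3) (1 : ℝ)) := by
  have hd : DifferentiableAt ℝ (A j) x := ((contDiff_jetA hu hA j (N := 1)).differentiable (by simp)) x
  have hc := ((EuclideanSpace.proj (𝕜 := ℝ) i).hasFDerivAt.comp x hd.hasFDerivAt).fderiv
  have e1 : fderiv ℝ (A j) x (EuclideanSpace.single l 1) i = fderiv ℝ (fun x => A j x i) x (EuclideanSpace.single l 1) := by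
    rw [show (fun x => A j x i) = (EuclideanSpace.proj (𝕜 := ℝ) i) ∘ A j from rfl, hc]; rfl
  have e2 : (fun x => A j x i) = fun x => iteratedFDeriv ℝ (j + 1) (fun y => u y (Fin.castSucc i)) (ι x) (fun _ => EuclideanSpace.single (2 : Fin 3) (1 : ℝ)) := by
    funext x; exact hA j x i
  rw [e1, e2, fderiv_jet_comp_embed (analyticOnNhd_coord hu _) hι0 hι1 hι2]

/-! ### (S) structure of the jets -/

/-- **(S), curl part**: `ω₂ = ∂₀u₁ − ∂₁u₀ ≡ 0` ⇒ every horizontal jet is curl-free: `∂₀(A j)₁ = ∂₁(A j)₀`. -/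
theorem curl_jetA (hu : AnalyticOnNhd ℝ u univ) (hι0 : ∀ x, ι x 0 = x 0) (hι1 : ∀ x, ι x 1 = x 1) (hι2 : ∀ x, ι x 2 = 0)
    (hA : ∀ j x (i : Fin 2), A j x i = iteratedFDeriv ℝ (j + 1) (fun y => u y (Fin.castSucc i)) (ι x) (fun _ => EuclideanSpace.single (2 : Fin 3) (1 : ℝ)))
    (hcurl : ∀ y, fderiv ℝ u y (EuclideanSpace.single 0 1) 1 = fderiv ℝ u y (EuclideanSpace.single 1 1) 0) (j : ℕ) (x : EuclideanSpace ℝ (Fin 2)) :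
    fderiv ℝ (A j) x (EuclideanSpace.single 0 1) 1 = fderiv ℝ (A j) x (EuclideanSpace.single 1 1) 0 := by
  rw [fderiv_jetA_apply hu hι0 hι1 hι2 hA j x 0 1, fderiv_jetA_apply hu hι0 hι1 hι2 hA j x 1 0]
  have hud : Differentiable ℝ u := hu.contDiff (n := 1) |>.differentiable (by simp)
  have e : (fun y => fderiv ℝ (fun y => u y (Fin.castSucc (1 : Fin 2))) y (EuclideanSpace.single (Fin.castSucc (0 : Fin 2)) 1)) =
      fun y => fderiv ℝ (fun y => u y (Fin.castSucc (0 : Fin 2))) y (EuclideanSpace.single (Fin.castSucc (1 : Fin 2)) 1) := by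
    funext y
    have h0 := fderiv_coord_apply' (hud y) (1 : Fin 3) (EuclideanSpace.single 0 1)
    have h1 := fderiv_coord_apply' (hud y) (0 : Fin 3) (EuclideanSpace.single 1 1)
    simp only [Fin.castSucc_zero, Fin.castSucc_one]
    rw [h0, h1]
    exact hcurl y
  rw [e]
where
  /-- coordinate of a derivative -/
  fderiv_coord_apply' {y : EuclideanSpace ℝ (Fin 3)} (hy : DifferentiableAt ℝ u y) (i : Fin 3) (h : EuclideanSpace ℝ (Fin 3)) :
      fderiv ℝ (fun y => u y i) y h = fderiv ℝ u y h i := by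
    have hc := ((EuclideanSpace.proj (𝕜 := ℝ) i).hasFDerivAt.comp y hy.hasFDerivAt).fderiv
    rw [show (fun y => u y i) = (EuclideanSpace.proj (𝕜 := ℝ) i) ∘ u from rfl, hc]
    rfl

/-- Coordinate of a derivative of the field: `D(y ↦ u(y)ᵢ)(y)h = (Du(y)h)ᵢ`. -/
theorem fderiv_coord_apply (hu : AnalyticOnNhd ℝ u univ) (y : EuclideanSpace ℝ (Fin 3)) (i : Fin 3) (h : EuclideanSpace ℝ (Fin 3)) :
    fderiv ℝ (fun y => u y i) y h = fderiv ℝ u y h i :=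
  curl_jetA.fderiv_coord_apply' ((hu.contDiff (n := 1)).differentiable (by simp) y) i h

/-- **(S), divergence part**: `div u = ∂₀u₀ + ∂₁u₁ + ∂₂u₂ ≡ 0` ⇒ `∂₀(A j)₀ + ∂₁(A j)₁ = −B (j+2)`. -/
theorem div_jetA (hu : AnalyticOnNhd ℝ u univ) (hι0 : ∀ x, ι x 0 = x 0) (hι1 : ∀ x, ι x 1 = x 1) (hι2 : ∀ x, ι x 2 = 0)
    (hB : ∀ k x, B k x = iteratedFDeriv ℝ k (fun y => u y 2) (ι x) (fun _ => EuclideanSpace.single (2 : Fin 3) (1 : ℝ)))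
    (hA : ∀ j x (i : Fin 2), A j x i = iteratedFDeriv ℝ (j + 1) (fun y => u y (Fin.castSucc i)) (ι x) (fun _ => EuclideanSpace.single (2 : Fin 3) (1 : ℝ)))
    (hdiv : ∀ y, fderiv ℝ u y (EuclideanSpace.single 0 1) 0 + fderiv ℝ u y (EuclideanSpace.single 1 1) 1 + fderiv ℝ u y (EuclideanSpace.single 2 1) 2 = 0)
    (j : ℕ) (x : EuclideanSpace ℝ (Fin 2)) :
    fderiv ℝ (A j) x (EuclideanSpace.single 0 1) 0 + fderiv ℝ (A j) x (EuclideanSpace.single 1 1) 1 = -B (j + 2) x := by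
  rw [fderiv_jetA_apply hu hι0 hι1 hι2 hA j x 0 0, fderiv_jetA_apply hu hι0 hι1 hι2 hA j x 1 1, hB,
    iteratedFDeriv_succ_const ((analyticOnNhd_coord hu 2).contDiff) (j + 1)]
  set e₂ : EuclideanSpace ℝ (Fin 3) := EuclideanSpace.single (2 : Fin 3) (1 : ℝ) with he₂
  have hC : ∀ (i : Fin 3) (w : EuclideanSpace ℝ (Fin 3)), ContDiff ℝ ∞ (fun y => fderiv ℝ (fun y => u y i) y w) := fun i w =>
    ((analyticOnNhd_coord hu i).contDiff.fderiv_right (m := ∞) (by norm_cast)).clm_apply contDiff_const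
  have hsum : (fun y => fderiv ℝ (fun y => u y (Fin.castSucc (0 : Fin 2))) y (EuclideanSpace.single (Fin.castSucc (0 : Fin 2)) 1)) +
      (fun y => fderiv ℝ (fun y => u y (Fin.castSucc (1 : Fin 2))) y (EuclideanSpace.single (Fin.castSucc (1 : Fin 2)) 1)) =
      -(fun y => fderiv ℝ (fun y => u y 2) y e₂) := by
    funext y
    simp only [Pi.add_apply, Pi.neg_apply, Fin.castSucc_zero, Fin.castSucc_one]
    rw [fderiv_coord_apply hu y 0, fderiv_coord_apply hu y 1, fderiv_coord_apply hu y 2, he₂]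
    linarith [hdiv y]
  have hadd := congrArg (fun g => iteratedFDeriv ℝ (j + 1) g (ι x) (fun _ => e₂)) hsum
  simp only at hadd
  rw [iteratedFDeriv_add_apply ((hC _ _).contDiffAt.of_le (by exact_mod_cast le_top)) ((hC _ _).contDiffAt.of_le (by exact_mod_cast le_top)),
    iteratedFDeriv_neg_apply, add_apply, neg_apply] at hadd
  simp only [Fin.castSucc_zero, Fin.castSucc_one] at hadd ⊢
  rw [hadd]

/-! ### (T) the leading order of the bilinear (TH) identity -/

/-- `z`-derivatives of `z ↦ ∂₂u_i(ι x + z e₂)` at `0` are the jets `A j x i`. -/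
theorem iteratedDeriv_vertical (hu : AnalyticOnNhd ℝ u univ)
    (hA : ∀ j x (i : Fin 2), A j x i = iteratedFDeriv ℝ (j + 1) (fun y => u y (Fin.castSucc i)) (ι x) (fun _ => EuclideanSpace.single (2 : Fin 3) (1 : ℝ)))
    (j : ℕ) (x : EuclideanSpace ℝ (Fin 2)) (i : Fin 2) :
    iteratedDeriv j (fun z : ℝ => fderiv ℝ u (ι x + z • EuclideanSpace.single (2 : Fin 3) (1 : ℝ)) (EuclideanSpace.single (2 : Fin 3) (1 : ℝ)) (Fin.castSucc i)) 0 =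
      A j x i := by
  have e : (fun z : ℝ => fderiv ℝ u (ι x + z • EuclideanSpace.single (2 : Fin 3) (1 : ℝ)) (EuclideanSpace.single (2 : Fin 3) (1 : ℝ)) (Fin.castSucc i)) =
      fun z : ℝ => fderiv ℝ (fun y => u y (Fin.castSucc i)) (ι x + z • EuclideanSpace.single (2 : Fin 3) (1 : ℝ)) (EuclideanSpace.single (2 : Fin 3) (1 : ℝ)) := by
    funext z; rw [fderiv_coord_apply hu]
  rw [e, iteratedDeriv_line_fderiv ((analyticOnNhd_coord hu _).contDiff), hA, iteratedFDeriv_succ_const ((analyticOnNhd_coord hu _).contDiff)]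

/-- `z`-derivatives of `z ↦ ∂ₗu₂(ι x + z e₂)` at `0` are the planar derivatives `∂ₗ(B k)(x)`. -/
theorem iteratedDeriv_horizontal (hu : AnalyticOnNhd ℝ u univ) (hι0 : ∀ x, ι x 0 = x 0) (hι1 : ∀ x, ι x 1 = x 1) (hι2 : ∀ x, ι x 2 = 0)
    (hB : ∀ k x, B k x = iteratedFDeriv ℝ k (fun y => u y 2) (ι x) (fun _ => EuclideanSpace.single (2 : Fin 3) (1 : ℝ))) (k : ℕ)
    (x : EuclideanSpace ℝ (Fin 2)) (l : Fin 2) :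
    iteratedDeriv k (fun z : ℝ => fderiv ℝ u (ι x + z • EuclideanSpace.single (2 : Fin 3) (1 : ℝ)) (EuclideanSpace.single (Fin.castSucc l) 1) 2) 0 =
      fderiv ℝ (B k) x (EuclideanSpace.single l 1) := by
  have e : (fun z : ℝ => fderiv ℝ u (ι x + z • EuclideanSpace.single (2 : Fin 3) (1 : ℝ)) (EuclideanSpace.single (Fin.castSucc l) 1) 2) =
      fun z : ℝ => fderiv ℝ (fun y => u y 2) (ι x + z • EuclideanSpace.single (2 : Fin 3) (1 : ℝ)) (EuclideanSpace.single (Fin.castSucc l) 1) := by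
    funext z; rw [fderiv_coord_apply hu]
  rw [e, iteratedDeriv_line_fderiv ((analyticOnNhd_coord hu _).contDiff), fderiv_jetB_apply hu hι0 hι1 hι2 hB]

/-- **(T) THE LEADING ORDER OF THE (TH) IDENTITY.**  If `∂₂u_b(y)·∂_c u₂(y') = ∂₂u_c(y')·∂_b u₂(y)` whenever `y₂ = y'₂` (`b, c ≠ 2`), the horizontal
jets vanish below order `j₁` and the vertical jets `B k` are constant for `k = 0` and vanish for `1 ≤ k < k₀`, then
`A j₁ x i · ∂ₗ(B k₀)(x') = A j₁ x' l · ∂ᵢ(B k₀)(x)` for all `x, x' ∈ ℝ²`, `i, l`. -/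
theorem thLeading (hu : AnalyticOnNhd ℝ u univ) (hι0 : ∀ x, ι x 0 = x 0) (hι1 : ∀ x, ι x 1 = x 1) (hι2 : ∀ x, ι x 2 = 0)
    (hB : ∀ k x, B k x = iteratedFDeriv ℝ k (fun y => u y 2) (ι x) (fun _ => EuclideanSpace.single (2 : Fin 3) (1 : ℝ)))
    (hA : ∀ j x (i : Fin 2), A j x i = iteratedFDeriv ℝ (j + 1) (fun y => u y (Fin.castSucc i)) (ι x) (fun _ => EuclideanSpace.single (2 : Fin 3) (1 : ℝ)))
    (hTH : ∀ y y' : EuclideanSpace ℝ (Fin 3), y 2 = y' 2 → ∀ b c : Fin 3, b ≠ 2 → c ≠ 2 →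
      fderiv ℝ u y (EuclideanSpace.single 2 1) b * fderiv ℝ u y' (EuclideanSpace.single c 1) 2 =
        fderiv ℝ u y' (EuclideanSpace.single 2 1) c * fderiv ℝ u y (EuclideanSpace.single b 1) 2)
    {j₁ k₀ : ℕ} (hAvan : ∀ j < j₁, ∀ x, A j x = 0) {N : ℝ} (hB0 : ∀ x, B 0 x = N) (hBvan : ∀ k, 1 ≤ k → k < k₀ → ∀ x, B k x = 0)
    (x x' : EuclideanSpace ℝ (Fin 2)) (i l : Fin 2) :
    A j₁ x i * fderiv ℝ (B k₀) x' (EuclideanSpace.single l 1) = A j₁ x' l * fderiv ℝ (B k₀) x (EuclideanSpace.single i 1) := by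
  set e₂ : EuclideanSpace ℝ (Fin 3) := EuclideanSpace.single (2 : Fin 3) (1 : ℝ) with he₂
  -- the four line functions
  set f : ℝ → ℝ := fun z => fderiv ℝ u (ι x + z • e₂) e₂ (Fin.castSucc i) with hf
  set g : ℝ → ℝ := fun z => fderiv ℝ u (ι x' + z • e₂) (EuclideanSpace.single (Fin.castSucc l) 1) 2 with hg
  set f' : ℝ → ℝ := fun z => fderiv ℝ u (ι x' + z • e₂) e₂ (Fin.castSucc l) with hf'
  set g' : ℝ → ℝ := fun z => fderiv ℝ u (ι x + z • e₂) (EuclideanSpace.single (Fin.castSucc i) 1) 2 with hg'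
  -- smoothness of line functions of the form `z ↦ ∂_w u(p + z e₂) m`
  have hsm : ∀ (p w : EuclideanSpace ℝ (Fin 3)) (m : Fin 3), ContDiff ℝ ∞ (fun z : ℝ => fderiv ℝ u (p + z • e₂) w m) := by
    intro p w m
    have h1 : ContDiff ℝ ∞ (fun y => fderiv ℝ u y w m) :=
      (contDiff_piLp_apply (p := 2) (𝕜 := ℝ) (E := fun _ : Fin 3 => ℝ) (i := m)).comp
        ((hu.contDiff.fderiv_right (m := ∞) (by norm_cast)).clm_apply contDiff_const)
    exact h1.comp (contDiff_const.add (contDiff_id.smul contDiff_const))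
  -- the identity `f g = f' g'` along the line
  have hH : f * g = f' * g' := by
    funext z
    simp only [Pi.mul_apply, hf, hg, hf', hg']
    have hne : ∀ m : Fin 2, (Fin.castSucc m : Fin 3) ≠ 2 := by intro m; fin_cases m <;> decide
    exact hTH (ι x + z • e₂) (ι x' + z • e₂) (by rw [he₂, embed_line_apply_two hι2, embed_line_apply_two hι2]) _ _ (hne i) (hne l)
  -- Taylor data at `0`
  have hfj : ∀ j, iteratedDeriv j f 0 = A j x i := fun j => iteratedDeriv_vertical hu hA j x i
  have hf'j : ∀ j, iteratedDeriv j f' 0 = A j x' l := fun j => iteratedDeriv_vertical hu hA j x' l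
  have hgk : ∀ k, iteratedDeriv k g 0 = fderiv ℝ (B k) x' (EuclideanSpace.single l 1) := fun k => iteratedDeriv_horizontal hu hι0 hι1 hι2 hB k x' l
  have hg'k : ∀ k, iteratedDeriv k g' 0 = fderiv ℝ (B k) x (EuclideanSpace.single i 1) := fun k => iteratedDeriv_horizontal hu hι0 hι1 hι2 hB k x i
  have hBd : ∀ k, k < k₀ → ∀ (y : EuclideanSpace ℝ (Fin 2)) (m : Fin 2), fderiv ℝ (B k) y (EuclideanSpace.single m 1) = 0 := by
    intro k hk y m
    rcases Nat.eq_zero_or_pos k with rfl | hk1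
    · rw [show B 0 = fun _ => N from funext hB0]; simp
    · rw [show B k = fun _ => 0 from funext (hBvan k hk1 hk)]; simp
  have hvf : ∀ j < j₁, iteratedDeriv j f 0 = 0 := fun j hj => by rw [hfj, hAvan j hj]; rfl
  have hvf' : ∀ j < j₁, iteratedDeriv j f' 0 = 0 := fun j hj => by rw [hf'j, hAvan j hj]; rfl
  have hvg : ∀ k < k₀, iteratedDeriv k g 0 = 0 := fun k hk => by rw [hgk, hBd k hk]
  have hvg' : ∀ k < k₀, iteratedDeriv k g' 0 = 0 := fun k hk => by rw [hg'k, hBd k hk]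
  -- Leibniz at order `j₁ + k₀`
  have hcd : ∀ φ : ℝ → ℝ, ContDiff ℝ ∞ φ → ContDiffAt ℝ (j₁ + k₀ : ℕ) φ 0 := fun φ hφ => hφ.contDiffAt.of_le (by exact_mod_cast le_top)
  have h1 := iteratedDeriv_mul_lowest (hcd f (hsm _ _ _)) (hcd g (hsm _ _ _)) hvf hvg
  have h2 := iteratedDeriv_mul_lowest (hcd f' (hsm _ _ _)) (hcd g' (hsm _ _ _)) hvf' hvg'
  rw [hH] at h1
  rw [h1, hfj, hf'j, hgk, hg'k] at h2
  have hc : (0 : ℝ) < ((j₁ + k₀).choose j₁ : ℝ) := by exact_mod_cast Nat.choose_pos (by omega)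
  have h3 := mul_left_cancel₀ hc.ne' (show ((j₁ + k₀).choose j₁ : ℝ) * (A j₁ x' l * fderiv ℝ (B k₀) x (EuclideanSpace.single i 1)) =
    ((j₁ + k₀).choose j₁ : ℝ) * (A j₁ x i * fderiv ℝ (B k₀) x' (EuclideanSpace.single l 1)) by rw [← mul_assoc, ← mul_assoc]; linarith [h2])
  linarith [h3]

end Jets

end Summit.NavierStokesRegularity.NavierStokesRegularity.Theorems.PoloidalWindowDoorLrcModEntireTwistingTHJetStructure
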